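import Literature.IUT.HodgeArakelov.ThetaEvaluationCor112AtModelTateInversion
import Literature.AnabelianGeometry.EtaleTheta.ThetaKummerInversionBTwistNoGoTate
import HarnessLib

/-!
# [IUTchII] Cor. 1.12 (ii)∧(iii) AT THE [EtTh] TATE MODEL — NON-VACUOUS FORM: the point `μ_-` realised by the `ι`-FIXED GALOIS
# SECTION `D_{μ_-} := Π^tp_{X̲̲} ∩ inr(G_{ℚ_p})`, every point clause of the closer a THEOREM (proof-only; D-0079 K-L6)

S. Mochizuki, *Inter-universal Teichmüller theory II*, kurims manuscript (Dec. 2020), Cor. 1.12 (ii), (iii) pp. 56–58, Rmk. 1.4.1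
(ii) p. 28 («`D_{μ_-} ⊆ Π_Ÿ(Π)` … the decomposition group of the torsion point `μ_-`»), Cor. 2.4 (ii) (b) p. 70
[claim: Mochizuki2012, status: disputed] (IUTchII §1 Cor 1.12, kurims pp.56-58); S. Mochizuki, *The étale theta function …*,
Publ. RIMS **45** (2009) [EtTh], §1 pp. 11–14, Prop. 1.4 (iii) p. 22, Def. 2.1 / Prop. 2.2 (i) p. 36 (the inversion `ι`)
[cite: MochizukiEtTh2009, Prop 2.2 (i) p.36]; S. Mochizuki, *Semi-graphs of anabelioids* [SemiAnbd], §6 p. 71 («`I_x = D_x ∩ Δ^temp_X`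
is `{1}` if `x` is not a cusp», «`D_x` always surjects onto an open subgroup of `G_K`») [cite: MochizukiSemiAnbd2006, §6 p.71].
Cell `abc-iut`, seat abc-iut-w4-d043 (gen 8; lineage of record of the Cor. 1.12 model chain), row «COR112-AT-MODELTATE-SECTION»
(STATUS 2026-08-26T21:51:23Z), sequel of this lineage's `ThetaEvaluationCor112AtModelTate` (p459069) / `…Inversion` (p461458).
PROOF-ONLY: no definition, no instance, no new named fact; every input consumed BY NAME.

WHY / WHAT.  p459069 / p461458 instantiate this lineage's DECOMPOSITION-POINT closer (`…_decompPoint_min`, p439820), whose point binder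
is a closed point `y : (C.temperedCurveXuuOfLevelData _ gd).Pt`; at the stage-2 models the curve layer has NO closed points
(`curveχq`: `Pt := PEmpty`; the cusped twin `curveχq′`: every point a cusp), so THERE the binder type is EMPTY and everything from `y` on
holds for the trivial reason (NV self-audit, STATUS 21:04:38Z).  The closer underneath — this lineage's ABSTRACT-`D_{μ_-}` form
`EtaleLevels.cor112_model_of_cyclotomeTower` (gen 4) — only needs a closed subgroup `Dmu ≤ Π_Ÿ(Π)` with `hDmu`, `hfixD` (fixed by `ι_Ÿ` up
to `Π_Ÿ(Π)`-conjugacy), `hstd`, `hDq` (`Dmu ∩ Δ = 1`), `hDc` (compact), `[(Dmu.map aug).FiniteIndex]`; and THE TATE MODEL HAS ONE: the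
Galois section of record `inr(G_{ℚ_p})` lies in `Π^tp_{X̲̲} = Huuχq` (`inr_mem_Huuχq`) and in `Π^tp_Ÿ` (`map_inr_GKdd_le_GtpYdd_modelχq′`,
`K̈ = K`), meets `Δ^tp` trivially, is compact, maps ONTO `G_K`, and is FIXED POINTWISE by abc-iut-L2's inversion at `(i, j) = (1, 2)`
(`inversionχq_inr_tate`; the defect exponent `j − 2i` of `inversionχq_inr` vanishes exactly at the Tate pair of record) — the model's `μ_-`.
§1 proves these point clauses for `D := (inr.range).subgroupOf C.Huu` at every stage-2 model (`inrRange_subgroupOf_le_piYdd`,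
`eq_one_of_mem_inrRange_subgroupOf_of_aug_eq_one`, `isCompact_inrRange_subgroupOf`, `map_aug_inrRange_subgroupOf`,
`finiteIndex_map_aug_inrRange_subgroupOf`; at `(1, 2)` (abc-iut-L2's `inversionχq_inr_tate`): `inversionAlpha_mem_inrRange_subgroupOf`,
`exists_fixD_inrRange_subgroupOf`).  §2 **`ModelTateCarriers.cor112_model_modelTate_section`** = p461458's statement with the point
block `y hy hDmu hfixD` REPLACED by §1's theorems: residual `∀`-binders EXACTLY {`hP` (inhabited), `h218i₁` = F-0620 at level `1`,
(H1) `hcharY` = F-2633 at the instance, (R1) `huniq`, the standard-type class `etaStd hmem hstd`, `β hφ hβ`, (H1) `hΔX` (⟺ MChar,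
p466815), the Prop. 2.2 (ii) translates `tr htr hdesc hrev hfree`, `G`} — the conclusion under NO empty binder: the first carrier
in the tree at which the Cor. 1.12 (ii)(iii) model closer is instantiated non-vacuously (the theorem elaborates at `(p, l) = (13, 3)`).

HONEST LABEL: `modelTate` is a SEMI-SYNTHETIC model of the typed [EtTh] §1 interface (`Π^tp_X = (F̂₂ ×_Ẑ ℤ) ⋊ G_{ℚ_p}`, no theta
FUNCTION, not the tempered `π₁` of a curve); «`D_{μ_-} :=` the Galois section» is the model's reading of the torsion point — the
section IS `ι`-fixed and lies in `Π^tp_{Ÿ̲̲}`, which is all the closer asks of `μ_-` besides the standard-type value clause `hstd` (kept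
NAMED).  Joint-satisfiability / binder-discharge evidence for the typed interface; nothing of [IUTchII] (claim key `Mochizuki2012`,
DISPUTED, D-0012) or [EtTh] is asserted beyond the tree's proofs; no side is taken on [IUTchIII] Cor. 3.12; typed ≠ proved;
instantiated ≠ endorsed; nothing here says abc is proved or refuted.
-/

noncomputable section

namespace Literature.IUT.HodgeArakelov

open Literature.AnabelianGeometry.AbsoluteAnabelian
open Literature.AnabelianGeometry.EtaleTheta Literature.AnabelianGeometry.SemiGraphs CohomologySystemOfContH1
open Literature.AnabelianGeometry.EtaleTheta.SettingModel
open Literature.NumberTheory.GaloisRepresentations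
open scoped Literature.AnabelianGeometry.EtaleTheta

namespace ModelTateCarriers

/-! ## §1. The point clauses of `D := Π^tp_{X̲̲} ∩ inr(G_{ℚ_p})` at the stage-2 models -/

section SectionSubgroup

variable (p : ℕ) [Fact p.Prime] (i j : ℤ) (hj : Even j)
  {E : (ThetaSetting.modelχq p i j hj).EtaleThetaData} {l : ℕ} (C : E.DoubleUnderline l)

/-- Membership in `Π^tp_{X̲̲} ∩ inr(G_{ℚ_p})`, read inside `Π_v = Π^tp_{X̲̲}`. [cite: MochizukiEtTh2009, §1 p.12] -/
theorem mem_inrRange_subgroupOf_iff (x : EtaleThetaDataOfSetting.Pi C) :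
    x ∈ ((SemidirectProduct.inr : GQp p →* PiTpχq p i j).range).subgroupOf C.Huu ↔
      ∃ σ : GQp p, SemidirectProduct.inr σ = (x : PiTpχq p i j) := by
  rw [Subgroup.mem_subgroupOf, MonoidHom.mem_range]

/-- **hDmu**: `Π^tp_{X̲̲} ∩ inr(G_{ℚ_p}) ≤ Π_Ÿ(Π) = Π^tp_Ÿ ∩ Π^tp_{X̲̲}` — `inr(G_K̈) ≤ Π^tp_Ÿ` (abc-iut-L2 `map_inr_GKdd_le_GtpYdd_modelχq′`)
and `K̈ = K = ℚ_p` at the model (`Sec2Hyps.GKdd_eq`, `GK_modelχq`). [claim: Mochizuki2012, status: disputed] (IUTchII §1 Rmk 1.4.1 (ii), kurims p.28) -/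
theorem inrRange_subgroupOf_le_piYdd (hS : (ThetaSetting.modelχq p i j hj).Sec2Hyps) :
    ((SemidirectProduct.inr : GQp p →* PiTpχq p i j).range).subgroupOf C.Huu ≤ EtaleThetaDataOfSetting.PiYdd C := by
  intro x hx
  obtain ⟨σ, hσ⟩ := (mem_inrRange_subgroupOf_iff p i j hj C x).1 hx
  refine Subgroup.mem_subgroupOf.2 (Subgroup.mem_inf.2 ⟨?_, x.2⟩)
  rw [← hσ]
  refine map_inr_GKdd_le_GtpYdd_modelχq' p i j hj ⟨σ, ?_, rfl⟩
  rw [hS.GKdd_eq, GK_modelχq]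
  trivial

/-- **hDq**: `D ∩ Δ^tp = 1` for `D = Π^tp_{X̲̲} ∩ inr(G_{ℚ_p})` («`I_x = {1}` if `x` is not a cusp»): `aug ∘ inr = id`.
[cite: MochizukiSemiAnbd2006, §6 p.71] -/
theorem eq_one_of_mem_inrRange_subgroupOf_of_aug_eq_one (d : EtaleThetaDataOfSetting.Pi C)
    (hd : d ∈ ((SemidirectProduct.inr : GQp p →* PiTpχq p i j).range).subgroupOf C.Huu)
    (h : EtaleThetaDataOfSetting.aug C d = 1) : d = 1 := by
  obtain ⟨σ, hσ⟩ := (mem_inrRange_subgroupOf_iff p i j hj C d).1 hd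
  have hσ1 : σ = 1 := by
    have : EtaleThetaDataOfSetting.aug C d = σ := by
      change augχq p i j (d : PiTpχq p i j) = σ
      rw [← hσ]
      rfl
    rw [← this, h]
  apply Subtype.ext
  change (d : PiTpχq p i j) = 1
  rw [← hσ, hσ1, map_one]

/-- **hDc**: `Π^tp_{X̲̲} ∩ inr(G_{ℚ_p})` is compact — the continuous image of the compact `G_{ℚ_p}` (abc-iut-L2 `compactSpace_GQp`,
`continuous_inrχq`), given `inr(G_{ℚ_p}) ⊆ Π^tp_{X̲̲}`. [cite: MochizukiSemiAnbd2006, §6 p.71] -/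
theorem isCompact_inrRange_subgroupOf (hinr : ∀ σ : GQp p, (SemidirectProduct.inr σ : PiTpχq p i j) ∈ C.Huu) :
    IsCompact ((((SemidirectProduct.inr : GQp p →* PiTpχq p i j).range).subgroupOf C.Huu :
      Subgroup (EtaleThetaDataOfSetting.Pi C)) : Set (EtaleThetaDataOfSetting.Pi C)) := by
  haveI : CompactSpace (GQp p) := compactSpace_GQp p
  have hcont : Continuous fun σ : GQp p => (⟨SemidirectProduct.inr σ, hinr σ⟩ : EtaleThetaDataOfSetting.Pi C) :=
    (continuous_inrχq p i j).subtype_mk _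
  have hrange : ((((SemidirectProduct.inr : GQp p →* PiTpχq p i j).range).subgroupOf C.Huu :
      Subgroup (EtaleThetaDataOfSetting.Pi C)) : Set (EtaleThetaDataOfSetting.Pi C)) =
      Set.range fun σ : GQp p => (⟨SemidirectProduct.inr σ, hinr σ⟩ : EtaleThetaDataOfSetting.Pi C) := by
    ext x
    rw [SetLike.mem_coe, mem_inrRange_subgroupOf_iff, Set.mem_range]
    constructor
    · rintro ⟨σ, hσ⟩
      exact ⟨σ, Subtype.ext hσ⟩
    · rintro ⟨σ, hσ⟩
      exact ⟨σ, congrArg Subtype.val hσ⟩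
  rw [hrange]
  exact isCompact_range hcont

/-- `aug(Π^tp_{X̲̲} ∩ inr(G_{ℚ_p})) = G_{ℚ_p}` («`D_x` always surjects onto an open subgroup of `G_K`» — here all of it).
[cite: MochizukiSemiAnbd2006, §6 p.71] -/
theorem map_aug_inrRange_subgroupOf (hinr : ∀ σ : GQp p, (SemidirectProduct.inr σ : PiTpχq p i j) ∈ C.Huu) :
    (((SemidirectProduct.inr : GQp p →* PiTpχq p i j).range).subgroupOf C.Huu).map (EtaleThetaDataOfSetting.aug C) = ⊤ := by
  refine top_le_iff.1 fun σ _ => ?_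
  refine ⟨⟨SemidirectProduct.inr σ, hinr σ⟩, (mem_inrRange_subgroupOf_iff p i j hj C _).2 ⟨σ, rfl⟩, ?_⟩
  change augχq p i j (SemidirectProduct.inr σ) = σ
  rfl

/-- Hence `aug(Π^tp_{X̲̲} ∩ inr(G_{ℚ_p}))` has finite index (`= 1`) in `G_{ℚ_p}` — the closer's instance binder
`[(D_{μ_-}.map aug).FiniteIndex]`. [cite: MochizukiSemiAnbd2006, §6 p.71] -/
theorem finiteIndex_map_aug_inrRange_subgroupOf (hinr : ∀ σ : GQp p, (SemidirectProduct.inr σ : PiTpχq p i j) ∈ C.Huu) :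
    ((((SemidirectProduct.inr : GQp p →* PiTpχq p i j).range).subgroupOf C.Huu).map (EtaleThetaDataOfSetting.aug C)).FiniteIndex := by
  rw [map_aug_inrRange_subgroupOf p i j hj C hinr]
  infer_instance

end SectionSubgroup

section TatePair

variable (p : ℕ) [Fact p.Prime] {E : (ThetaSetting.modelχq p 1 2 even_two).EtaleThetaData} {l : ℕ} (C : E.DoubleUnderline l)

/-- `α := ι|Π^tp_{X̲̲}` (abc-iut-w5-d072's `inversionAlpha`) carries `Π^tp_{X̲̲} ∩ inr(G_{ℚ_p})` into itself — pointwise fixed, in fact.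
[claim: Mochizuki2012, status: disputed] (IUTchII §1 Rmk 1.4.1 (ii), kurims p.28) -/
theorem inversionAlpha_mem_inrRange_subgroupOf
    (hι : C.Huu.map (inversionχq p 1 2).toMulEquiv.toMonoidHom = C.Huu) (d : EtaleThetaDataOfSetting.Pi C)
    (hd : d ∈ ((SemidirectProduct.inr : GQp p →* PiTpχq p 1 2).range).subgroupOf C.Huu) :
    EtaleThetaDataOfSetting.inversionAlpha C (inversionχq p 1 2) hι d ∈
      ((SemidirectProduct.inr : GQp p →* PiTpχq p 1 2).range).subgroupOf C.Huu := by
  obtain ⟨σ, hσ⟩ := (mem_inrRange_subgroupOf_iff p 1 2 even_two C d).1 hd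
  refine (mem_inrRange_subgroupOf_iff p 1 2 even_two C _).2 ⟨σ, ?_⟩
  rw [EtaleThetaDataOfSetting.coe_inversionAlpha]
  change SemidirectProduct.inr σ = inversionχq p 1 2 (d : PiTpχq p 1 2)
  rw [← hσ, inversionχq_inr_tate]

/-- **hfixD with `δ' := 1`**: «`D_{μ_-}` is fixed by `ι_Ÿ` up to `Π_Ÿ(Π)`-conjugacy» holds at `D_{μ_-} := Π^tp_{X̲̲} ∩ inr(G_{ℚ_p})` with the
TRIVIAL conjugator, for `ι_Ÿ :=` abc-iut-w5-d072's `iotaYddOfAut` of `α := ι|Π^tp_{X̲̲}` (any (H1) witness `hchar`), and any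
clause `P` holding at `1` (the consumer's `P := (Env.recon.projG (Env.isoX ·) = 1)`, where `P 1` is `hδ`).
[claim: Mochizuki2012, status: disputed] (IUTchII §1 Rmk 1.4.1 (ii), kurims p.28) -/
theorem exists_fixD_inrRange_subgroupOf (hι : C.Huu.map (inversionχq p 1 2).toMulEquiv.toMonoidHom = C.Huu)
    (hchar : EtaleThetaDataOfSetting.PiYddCharacteristic C) (hS : (ThetaSetting.modelχq p 1 2 even_two).Sec2Hyps)
    (P : EtaleThetaDataOfSetting.Pi C → Prop) (hP1 : P 1) :
    ∃ δ' : ↥(EtaleThetaDataOfSetting.PiYdd C), P (δ' : EtaleThetaDataOfSetting.Pi C) ∧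
      ∀ (d : EtaleThetaDataOfSetting.Pi C)
        (hd : d ∈ ((SemidirectProduct.inr : GQp p →* PiTpχq p 1 2).range).subgroupOf C.Huu),
        ((EtaleThetaDataOfSetting.iotaYddOfAut C hchar (EtaleThetaDataOfSetting.inversionAlpha C (inversionχq p 1 2) hι)
          ⟨d, inrRange_subgroupOf_le_piYdd p 1 2 even_two C hS hd⟩ : EtaleThetaDataOfSetting.PiYdd C) :
          EtaleThetaDataOfSetting.Pi C) ∈
          (((SemidirectProduct.inr : GQp p →* PiTpχq p 1 2).range).subgroupOf C.Huu).map
            (MulAut.conj ((δ' : EtaleThetaDataOfSetting.PiYdd C) : EtaleThetaDataOfSetting.Pi C)).toMonoidHom := by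
  refine ⟨1, by rwa [OneMemClass.coe_one], fun d hd => Subgroup.mem_map.2 ⟨_, inversionAlpha_mem_inrRange_subgroupOf p C hι d hd, ?_⟩⟩
  rw [EtaleThetaDataOfSetting.coe_iotaYddOfAut, OneMemClass.coe_one, map_one]
  rfl

end TatePair

/-! ## §2. [IUTchII] Cor. 1.12 (ii)∧(iii) at the Tate model with `D_{μ_-} := Π^tp_{X̲̲} ∩ inr(G_{ℚ_p})` — NON-VACUOUS -/

section Tate

variable (p : ℕ) [Fact p.Prime] (l : ℕ+) (hl : Odd (l : ℕ)) (hlp : (l : ℕ).Prime) (hdvd : 4 * (l : ℕ) ∣ p - 1)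
  {Es : Set ℕ+} (τ : (ThetaSetting.modelχq p 1 2 even_two).CyclotomeTower l Es)

/-- **[IUTchII] Cor. 1.12 (ii) AND (iii) at the model, AT THE [EtTh] TATE MODEL, with `D_{μ_-} := Π^tp_{X̲̲} ∩ inr(G_{ℚ_p})` — the
NON-VACUOUS instance.**  abc-iut-w4-d043's ABSTRACT-`D_{μ_-}` closer `EtaleLevels.cor112_model_of_cyclotomeTower` over
abc-iut-w5-d233's carriers of record (`inr`-section étale-theta datum carrying `η̈♯ = etaDdχq`, `Π^tp_{X̲̲} = Huuχq`, root cocycle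
`rootLift C`, cyclotome tower `τ`), with: the [EtTh] data and `hC hS hO hYcl h15 hζ hp2 hpl hf hZ`, `Δ_Θ` compact, the base MLF
`(k, ε) := (ℚ_p, σ ↦ σ)`, (H2) `hq` (abc-iut-w4-d030), the Prop. 1.2 (i) output `Env₀ :=` the B8 `envOfGroup` (any `hP`), the (R1)
EXISTENCE data `α := ι|Π^tp_{X̲̲}`, `δ := 1`, `γ`, `hδ hαα hγ hαγ hα` and `hover ⟸ h218i₁` (as in p461458), AND NOW the point data of
`D_{μ_-} := Π^tp_{X̲̲} ∩ inr(G_{ℚ_p})` — `hDmu`, `hfixD` (`δ' := 1`: `ι` fixes the section), `hDq`, `hDc`, `[(D_{μ_-}.map aug).FiniteIndex]`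
— ALL theorems / data of the tree.  Residual `∀`-binders, each NAMED: `hP` (inhabited), `h218i₁` (F-0620 at level `1`), (H1) `hcharY`
(F-2633 at the instance), (R1) `huniq`, the standard-type class `etaStd hmem hstd`, `β hφ hβ`, (H1) `hΔX` (⟺ MChar, p466815), the
Prop. 2.2 (ii) translates `tr htr hdesc hrev hfree`, `G`.  Conclusion VERBATIM that of the closer at these data; the conclusion is
under NO empty binder. [claim: Mochizuki2012, status: disputed] (IUTchII §1 Cor 1.12 (ii)(iii), kurims pp.56-58) -/
theorem cor112_model_modelTate_section :
    -- THE POINT `μ_-` OF THE MODEL: the Galois section of record `inr(G_{ℚ_p}) ≤ Π^tp_X` (its trace on `Π^tp_{X̲̲}` is `D_{μ_-}` below)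
    let Dsec : Subgroup (PiTpχq p 1 2) := (SemidirectProduct.inr : GQp p →* PiTpχq p 1 2).range
    -- (R1) AT THE TATE MODEL: abc-iut-L2's stage-2 inversion `ι := inversionχq` of `Π^tp_X` (over `K`, `−1` on `Z`, involutive; FIXES `Dsec`)
    let ι := inversionχq p 1 2
    let hιA : (ThetaSetting.modelχq p 1 2 even_two).IsInversionAut ι := isInversionAut_inversionχq p 1 2 even_two
    let hC := compat_modelχq p 1 2 even_two
    let hS := ThetaSetting.modelχq_sec2Hyps p 1 2 even_two
    let K₀ := (kummerCoreχq p 1 2 even_two).toKummerDataOfSection SemidirectProduct.inr (continuous_inrχq p 1 2)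
        (fun _ => rfl) (map_inr_GK_le_GtpY_modelχq' p 1 2 even_two) (map_inr_GKdd_le_GtpYdd_modelχq' p 1 2 even_two)
    let C := (K₀.etaleThetaDataOfClass (etaDdχq p 1 2 even_two)).doubleUnderlineχqOfEtaRes p 1 2 l hl
        (eta_res_etaDdχq p 1 2 even_two l hl)
    -- the ROOT COCYCLE of the `EtaleLevels` chain: abc-iut-L6-t1's one-root lift (abc-iut-w5-d233 `rootLift_mem_rootCocycles`)
    let f := EtaleThetaDataOfSetting.rootLift C
    let hf : f ∈ C.rootCocycles hC := rootLift_mem_rootCocycles C hC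
    let h15 : Literature.AnabelianGeometry.EtaleTheta.ThetaSetting.Prop15iii _ hC :=
      prop15iii_etaleThetaDataOfClass_etaDdχq p hC SemidirectProduct.inr
        (continuous_inrχq p 1 2) (fun _ => rfl) (map_inr_GK_le_GtpY_modelχq' p 1 2 even_two)
        (map_inr_GKdd_le_GtpYdd_modelχq' p 1 2 even_two)
    let L : C.CuspLabels := ⟨fun _ => ∅, fun _ => ∅, fun _ => rfl⟩
    let hO := ThetaSetting.modelχq_isEtThOrigin p 1 2 even_two
    let hYcl := hYcl_modelχq p 1 2 even_two
    let hp2 := ne_two_of_four_mul_dvd_pred p l.pos hdvd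
    let hpl := ne_of_four_mul_dvd_pred p l.pos hdvd
    let hζ := exists_isPrimitiveRoot_K_modelχq p 1 2 even_two l.pos hdvd
    let hZ : ∀ M : ℕ+, Nonempty (ModelCyclotomes.lDeltaQuot (C.rigidData (τ.modAll M) hC hS h15 L) ≃*
        Literature.IUT.HodgeTheaters.ZHat) := fun M =>
      ModelCyclotomes.nonempty_lDeltaQuot_rigidData_mulEquiv_zHat C (τ.modAll M) hC hS h15 L hO hYcl hlp.ne_zero
    -- the generic instances of the Cor. 1.12 vocabulary, re-supplied at the (reducible) Tate-model carriers
    haveI : ((ThetaSetting.modelχq p 1 2 even_two).lDeltaTheta l).Normal := (ThetaSetting.modelχq p 1 2 even_two).lDeltaTheta_normal l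
    haveI : IsMulCommutative ((ThetaSetting.modelχq p 1 2 even_two).lDeltaTheta l) :=
      EtaleThetaDataOfSetting.instIsMulCommutative_lDeltaTheta (D := ThetaSetting.modelχq p 1 2 even_two) l
    letI : MulDistribMulAction (EtaleThetaDataOfSetting.Pi C) (PadicAlgCl p)ˣ := EtaleThetaDataOfSetting.unitsAction C
    -- (H2) `Π/Δ ≅ G_K` at the `EtaleLevels` setting of the Tate model: abc-iut-w4-d030's THEOREM `hq_setting_modelTate` (p456925)
    let hq : Nonempty (TopGroup.quot (EtaleLevels.setting C hC hS hlp hp2 hpl hζ τ.modAll f hf).PiX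
        (EtaleLevels.setting C hC hS hlp hp2 hpl hζ τ.modAll f hf).DeltaX ≃ₜ*
        (EtaleLevels.setting C hC hS hlp hp2 hpl hζ τ.modAll f hf).Gk) :=
      hq_setting_modelTate p l hl hlp hdvd τ
    -- `ι` stabilises `Π^tp_X̲̲`; `α := ι|Π^tp_X̲̲` (abc-iut-w5-d072 `inversionAlpha`); `δ := 1`; a `toLZ`-generator `γ`
    let hι : C.Huu.map ι.toMulEquiv.toMonoidHom = C.Huu := map_Huuχq_inversionχq p 1 2 l hl
    let α : (EtaleThetaDataOfSetting.Pi C) ≃ₜ* (EtaleThetaDataOfSetting.Pi C) := EtaleThetaDataOfSetting.inversionAlpha C ι hι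
    let hαα : ∀ x : EtaleThetaDataOfSetting.Pi C, α (α x) = 1 * x * 1⁻¹ :=
      EtaleThetaDataOfSetting.inversionAlpha_inversionAlpha_of_sq C ι hι 1
        (EtaleThetaDataOfSetting.sq_conj_one_of_involutive C ι (inversionχq_inversionχq p 1 2))
    let γ : EtaleThetaDataOfSetting.Pi C := (C.toLZ_surjective (Multiplicative.ofAdd 1)).choose
    let hγ : C.toLZ γ = Multiplicative.ofAdd 1 := (C.toLZ_surjective (Multiplicative.ofAdd 1)).choose_spec
    let hαγ : C.toLZ (α γ) = Multiplicative.ofAdd (-1) :=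
      EtaleThetaDataOfSetting.toLZ_inversionAlpha_generator C ι hι γ hγ (hιA.toZ_apply γ)
    -- the [IUTchII] Prop. 1.2 (i) output `Env₀ :=` abc-iut-L6-d6's GENUINE `ThetaSetting.envOfGroup` of the Tate curve (bridge B8), for
    -- EVERY identification `hP` (inhabited: `⟨ContinuousMulEquiv.refl _⟩`); its `projG ∘ isoX` kills exactly `Ker(aug)` modulo F-0620
    ∀ (hP : Nonempty ((EtaleThetaDataOfSetting.Pi C) ≃ₜ* (EtaleLevels.setting C hC hS hlp hp2 hpl hζ τ.modAll f hf).PiX)),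
    let Env₀ : EnvOfGroup (EtaleLevels.setting C hC hS hlp hp2 hpl hζ τ.modAll f hf)
        (EtaleLevels.modelSystem C hC hS hlp hp2 hpl hζ τ.modAll f hf τ.red_modAll h15 L hZ).PiX :=
      ThetaSetting.envOfGroup (C.rigidData (τ.modAll 1) hC hS h15 L)
        (ThetaSetting.SideData.ofDoubleUnderline C (τ.modAll 1) hC hS hlp hp2 hpl hζ (EtaleLevels.eta0_mem C hC hS τ.modAll f hf 1))
        (ThetaSetting.t1Space_Huu C) (ThetaSetting.isClosed_ker_aug_thetaEnvData C (τ.modAll 1) hC hS) (hZ 1)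
        (EtaleThetaDataOfSetting.Pi C) hP
    let hδ : Env₀.recon.projG (Env₀.isoX 1) = 1 :=
      EtaleThetaDataOfSetting.projG_isoX_envOfGroup_one C (τ.modAll 1) hC hS h15 L hlp hp2 hpl hζ
        (EtaleLevels.eta0_mem C hC hS τ.modAll f hf 1) (hZ 1) hP
    -- RESIDUAL named inputs: F-0620 ([EtTh] Cor. 2.18 (i)) at level `1` of `τ` — from which `hover` FOLLOWS (p461458) — then (H1)
    -- `hcharY`, after which the POINT DATA of `D_{μ_-} := Π^tp_{X̲̲} ∩ inr(G_{ℚ_p})` are THEOREMS (§1), then the rest of the custody list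
    ∀ (h218i₁ : (C.rigidData (τ.modAll 1) hC hS h15 L).Cor218_i),
    let hover : ∀ x : EtaleThetaDataOfSetting.Pi C, Env₀.recon.projG (Env₀.isoX (α x)) = Env₀.recon.projG (Env₀.isoX x) :=
      fun x => EtaleThetaDataOfSetting.projG_isoX_envOfGroup_inversionAlpha_of_cor218_i C ι hι (τ.modAll 1) hC hS h15 L hlp
        hp2 hpl hζ (EtaleLevels.eta0_mem C hC hS τ.modAll f hf 1) (hZ 1) hP _ rfl h218i₁ hιA x
    ∀ (hcharY : EtaleThetaDataOfSetting.PiYddCharacteristic C),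
    -- «y = μ_-» AT THE MODEL, EVERY point clause a THEOREM: `D_{μ_-} := Π^tp_{X̲̲} ∩ inr(G_{ℚ_p})`, the `ι`-FIXED Galois section
    -- of record (`inversionχq_inr` at `(i, j) = (1, 2)`), inside `Π_Ÿ(Π)` since `K̈ = K` (`hDmu`), compact, `D_{μ_-} ∩ Δ = 1`,
    -- `aug(D_{μ_-}) = G_K`; «fixed by `ι_Ÿ` up to `Π_Ÿ(Π)`-conjugacy» with `δ' := 1` (`hfixD`)
    let Dμ : Subgroup (EtaleThetaDataOfSetting.Pi C) := Dsec.subgroupOf C.Huu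
    let hDmu : Dμ ≤ EtaleThetaDataOfSetting.PiYdd C := inrRange_subgroupOf_le_piYdd p 1 2 even_two C hS
    let hfixD : ∃ δ' : ↥(EtaleThetaDataOfSetting.PiYdd C), Env₀.recon.projG (Env₀.isoX (δ' : EtaleThetaDataOfSetting.Pi C)) = 1 ∧
        ∀ (d : EtaleThetaDataOfSetting.Pi C) (hd : d ∈ Dμ),
          ((EtaleThetaDataOfSetting.iotaYddOfAut C hcharY α ⟨d, hDmu hd⟩ :
          EtaleThetaDataOfSetting.PiYdd C) : EtaleThetaDataOfSetting.Pi C) ∈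
            Dμ.map (MulAut.conj ((δ' : EtaleThetaDataOfSetting.PiYdd C) : EtaleThetaDataOfSetting.Pi C)).toMonoidHom :=
      exists_fixD_inrRange_subgroupOf p C hι hcharY hS (fun x => Env₀.recon.projG (Env₀.isoX x) = 1) hδ
    ∀ -- (R1) residual: the UNIQUENESS clause only («the unique order two `Δ`-outer automorphism over `G_k`», tempered-anabelian)
      (huniq : ∀ κ : (EtaleThetaDataOfSetting.Pi C) ≃ₜ* (EtaleThetaDataOfSetting.Pi C),
        (∀ x, Env₀.recon.projG (Env₀.isoX (κ x)) = Env₀.recon.projG (Env₀.isoX x)) →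
        (∃ δ' : EtaleThetaDataOfSetting.Pi C, Env₀.recon.projG (Env₀.isoX δ') = 1 ∧ ∀ x, κ (κ x) = δ' * x * δ'⁻¹) →
        (¬ ∃ δ' : EtaleThetaDataOfSetting.Pi C, Env₀.recon.projG (Env₀.isoX δ') = 1 ∧ ∀ x, κ x = δ' * x * δ'⁻¹) →
          ∃ δ' : EtaleThetaDataOfSetting.Pi C, Env₀.recon.projG (Env₀.isoX δ') = 1 ∧ ∀ x, κ x = δ' * α x * δ'⁻¹)
      -- «standard type at `D_{μ_-}`»: an orbit member whose restriction to `D_{μ_-}` is `2l`-torsion (value clause, kept NAMED here)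
      (etaStd : (EtaleThetaDataOfSetting.coh C).H1 ⊤) (hmem : etaStd ∈ EtaleThetaDataOfSetting.orbitOne C hC)
      (hstd : (2 * (EtaleLevels.setting C hC hS hlp hp2 hpl hζ τ.modAll f hf).l) •
        EtaleThetaDataOfSetting.resDmuOf C Dμ hDmu etaStd = 0)
      -- the coefficient half of the pair and its printed properties
      (β : (ThetaSetting.modelχq p 1 2 even_two).GtpTheta ≃ₜ* (ThetaSetting.modelχq p 1 2 even_two).GtpTheta)
      (hφ : ∀ g, β (EtaleThetaDataOfSetting.phi C g) = EtaleThetaDataOfSetting.phi C (α g))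
      -- (H1) `Δ` characteristic, for the GENUINE [AbsTopIII]-output data over `(K, ℚ̄_p, ε = id)` (k, ε, (H2) hq DISCHARGED below)
      (hΔX : ∀ φ : (EtaleLevels.setting C hC hS hlp hp2 hpl hζ τ.modAll f hf).PiX ≃ₜ* (EtaleLevels.setting C hC hS hlp hp2 hpl hζ τ.modAll f hf).PiX,
        (EtaleLevels.setting C hC hS hlp hp2 hpl hζ τ.modAll f hf).DeltaX.map φ.toMulEquiv.toMonoidHom =
          (EtaleLevels.setting C hC hS hlp hp2 hpl hζ τ.modAll f hf).DeltaX)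
      (hβ : ∀ a : (ThetaSetting.modelχq p 1 2 even_two).GtpTheta, a ∈ (ThetaSetting.modelχq p 1 2 even_two).lDeltaTheta l → β a = a)
      (tr : ℤ → (EtaleThetaDataOfSetting.coh C).H1 ⊤) (htr : tr 0 = etaStd)
      (hdesc : ∀ o ∈ EtaleThetaDataOfSetting.orbitOne C hC,
        ∃ (n : ℤ) (c' : (EtaleThetaDataOfSetting.coh C).H1 ⊤), 2 • c' = 0 ∧ o = tr n + c')
      (hrev : ∀ n : ℤ, IsOfFinAddOrder (EtaleThetaDataOfSetting.pairRho C α β hφ (EtaleThetaDataOfSetting.mem_lDeltaTheta_iff_of_eq_self β hβ) (EtaleThetaDataOfSetting.mem_PiYdd_iff_of_piYddCharacteristic C hcharY α) (tr n) - tr (-n)))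
      (hfree : ∀ m n : ℤ, IsOfFinAddOrder (tr m - tr n) → m = n)
      (G : IsoClass (EtaleLevels.setting C hC hS hlp hp2 hpl hζ τ.modAll f hf).Gk),
      haveI := finiteIndex_map_aug_inrRange_subgroupOf p 1 2 even_two C (inr_mem_Huuχq p 1 2 l hl)
      ∃ cU : CyclotomeCoefficients (EtaleThetaDataOfSetting.phi C) ((ThetaSetting.modelχq p 1 2 even_two).lDeltaTheta l) (PadicAlgCl p)ˣ,
        Function.Bijective cU.hom ∧
        (∀ (ζ : Literature.AnabelianGeometry.EtaleTheta.cyclotome (PadicAlgCl p)ˣ) (M : ℕ+),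
          (((τ.modAll M).red (cU.hom ζ) : MuN p M) : (PadicAlgCl p)ˣ) = (ζ : ℕ+ → (PadicAlgCl p)ˣ) M) ∧
        Literature.IUT.HodgeArakelov.Cor112_ii
          (EtaleLevels.thetaEvaluation C hC hS hlp hp2 hpl hζ τ.modAll f hf τ.red_modAll h15 L hZ hcharY (EtaleLevels.bijective_rigidLimHom C hC hS hlp hp2 hpl hζ τ.modAll f hf τ.red_modAll h15 L hZ) Env₀
            (EtaleThetaDataOfSetting.pointedInversionOfPair C hC hS hcharY (EtaleLevels.setting C hC hS hlp hp2 hpl hζ τ.modAll f hf)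
              (ContinuousMulEquiv.refl _) rfl Env₀ α hover 1 hδ hαα γ hγ hαγ huniq Dμ hDmu hfixD etaStd hmem hstd)
            (LevelRetraction.ofAugmentation (EtaleThetaDataOfSetting.phi C) ((ThetaSetting.modelχq p 1 2 even_two).lDeltaTheta l)
              (EtaleThetaDataOfSetting.aug C) Dμ (eq_one_of_mem_inrRange_subgroupOf_of_aug_eq_one p 1 2 even_two C) (EtaleThetaDataOfSetting.PiYdd C)
              (EtaleThetaDataOfSetting.continuous_aug C) (EtaleLevels.aug_ker_acts_trivially C)
              (hlift_of_isCompact (EtaleThetaDataOfSetting.aug C) Dμ (EtaleThetaDataOfSetting.continuous_aug C) (isCompact_inrRange_subgroupOf p 1 2 even_two C (inr_mem_Huuχq p 1 2 l hl)))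
              (hemb_of_isCompact (EtaleThetaDataOfSetting.aug C) Dμ (EtaleThetaDataOfSetting.continuous_aug C) (isCompact_inrRange_subgroupOf p 1 2 even_two C (inr_mem_Huuχq p 1 2 l hl)) (eq_one_of_mem_inrRange_subgroupOf_of_aug_eq_one p 1 2 even_two C)))
            cU (EtaleThetaDataOfSetting.isOpen_stabilizer_units C) (EtaleThetaDataOfSetting.finiteIndex_stabilizer_units C)
            (unitGroup ℚ_[p] (PadicAlgCl p)) (EtaleThetaDataOfSetting.pairRhoLim C α β hφ (EtaleThetaDataOfSetting.mem_lDeltaTheta_iff_of_eq_self β hβ) (EtaleThetaDataOfSetting.mem_PiYdd_iff_of_piYddCharacteristic C hcharY α))) ∧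
        ∃ Δ : MuXmuDiagram
            (EtaleLevels.thetaEvaluation C hC hS hlp hp2 hpl hζ τ.modAll f hf τ.red_modAll h15 L hZ hcharY (EtaleLevels.bijective_rigidLimHom C hC hS hlp hp2 hpl hζ τ.modAll f hf τ.red_modAll h15 L hZ) Env₀
              (EtaleThetaDataOfSetting.pointedInversionOfPair C hC hS hcharY (EtaleLevels.setting C hC hS hlp hp2 hpl hζ τ.modAll f hf)
                (ContinuousMulEquiv.refl _) rfl Env₀ α hover 1 hδ hαα γ hγ hαγ huniq Dμ hDmu hfixD etaStd hmem hstd)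
              (LevelRetraction.ofAugmentation (EtaleThetaDataOfSetting.phi C) ((ThetaSetting.modelχq p 1 2 even_two).lDeltaTheta l)
                (EtaleThetaDataOfSetting.aug C) Dμ (eq_one_of_mem_inrRange_subgroupOf_of_aug_eq_one p 1 2 even_two C) (EtaleThetaDataOfSetting.PiYdd C)
                (EtaleThetaDataOfSetting.continuous_aug C) (EtaleLevels.aug_ker_acts_trivially C)
                (hlift_of_isCompact (EtaleThetaDataOfSetting.aug C) Dμ (EtaleThetaDataOfSetting.continuous_aug C) (isCompact_inrRange_subgroupOf p 1 2 even_two C (inr_mem_Huuχq p 1 2 l hl)))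
                (hemb_of_isCompact (EtaleThetaDataOfSetting.aug C) Dμ (EtaleThetaDataOfSetting.continuous_aug C) (isCompact_inrRange_subgroupOf p 1 2 even_two C (inr_mem_Huuχq p 1 2 l hl)) (eq_one_of_mem_inrRange_subgroupOf_of_aug_eq_one p 1 2 even_two C)))
              cU (EtaleThetaDataOfSetting.isOpen_stabilizer_units C) (EtaleThetaDataOfSetting.finiteIndex_stabilizer_units C)
              (unitGroup ℚ_[p] (PadicAlgCl p)) (EtaleThetaDataOfSetting.pairRhoLim C α β hφ (EtaleThetaDataOfSetting.mem_lDeltaTheta_iff_of_eq_self β hβ) (EtaleThetaDataOfSetting.mem_PiYdd_iff_of_piYddCharacteristic C hcharY α)))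
            (AbsTopMonoids.genuineOfModelIsm (EtaleLevels.setting C hC hS hlp hp2 hpl hζ τ.modAll f hf) (ThetaSetting.modelχq p 1 2 even_two).toTemperedCurve.mlfClosurePadic (ThetaSetting.modelχq p 1 2 even_two).toTemperedCurve.galoisEpsilonPadic hΔX hq) G
            ↥(AddCommGroup.torsion (EtaleLevels.thetaEnvData C hC hS hlp hp2 hpl hζ τ.modAll f hf τ.red_modAll h15 L hZ hcharY (EtaleLevels.bijective_rigidLimHom C hC hS hlp hp2 hpl hζ τ.modAll f hf τ.red_modAll h15 L hZ)).cohEnv.lim)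
            (AddCommGroup.torsion (EtaleLevels.thetaEnvData C hC hS hlp hp2 hpl hζ τ.modAll f hf τ.red_modAll h15 L hZ hcharY (EtaleLevels.bijective_rigidLimHom C hC hS hlp hp2 hpl hζ τ.modAll f hf τ.red_modAll h15 L hZ)).cohEnv.lim).subtype,
          Δ.poly₄₅ = {e | ∃ (φ : AbsTopMonoids.Genuine.qObj hq (IsoClass.base (EtaleLevels.setting C hC hS hlp hp2 hpl hζ τ.modAll f hf).PiX) ⟶ G)
              (gI : (AbsTopMonoids.genuineOfModelIsm (EtaleLevels.setting C hC hS hlp hp2 hpl hζ τ.modAll f hf) (ThetaSetting.modelχq p 1 2 even_two).toTemperedCurve.mlfClosurePadic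
                (ThetaSetting.modelχq p 1 2 even_two).toTemperedCurve.galoisEpsilonPadic hΔX hq).Ism G),
            ∀ (u : ↥(unitGroup ℚ_[p] (PadicAlgCl p)))
              (m : ↥(EtaleLevels.thetaEvaluation C hC hS hlp hp2 hpl hζ τ.modAll f hf τ.red_modAll h15 L hZ hcharY (EtaleLevels.bijective_rigidLimHom C hC hS hlp hp2 hpl hζ τ.modAll f hf τ.red_modAll h15 L hZ) Env₀
                (EtaleThetaDataOfSetting.pointedInversionOfPair C hC hS hcharY (EtaleLevels.setting C hC hS hlp hp2 hpl hζ τ.modAll f hf)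
                  (ContinuousMulEquiv.refl _) rfl Env₀ α hover 1 hδ hαα γ hγ hαγ huniq Dμ hDmu hfixD etaStd hmem hstd)
                (LevelRetraction.ofAugmentation (EtaleThetaDataOfSetting.phi C) ((ThetaSetting.modelχq p 1 2 even_two).lDeltaTheta l)
                  (EtaleThetaDataOfSetting.aug C) Dμ (eq_one_of_mem_inrRange_subgroupOf_of_aug_eq_one p 1 2 even_two C) (EtaleThetaDataOfSetting.PiYdd C)
                  (EtaleThetaDataOfSetting.continuous_aug C) (EtaleLevels.aug_ker_acts_trivially C)
                  (hlift_of_isCompact (EtaleThetaDataOfSetting.aug C) Dμ (EtaleThetaDataOfSetting.continuous_aug C) (isCompact_inrRange_subgroupOf p 1 2 even_two C (inr_mem_Huuχq p 1 2 l hl)))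
                  (hemb_of_isCompact (EtaleThetaDataOfSetting.aug C) Dμ (EtaleThetaDataOfSetting.continuous_aug C) (isCompact_inrRange_subgroupOf p 1 2 even_two C (inr_mem_Huuχq p 1 2 l hl)) (eq_one_of_mem_inrRange_subgroupOf_of_aug_eq_one p 1 2 even_two C)))
                cU (EtaleThetaDataOfSetting.isOpen_stabilizer_units C) (EtaleThetaDataOfSetting.finiteIndex_stabilizer_units C)
                (unitGroup ℚ_[p] (PadicAlgCl p)) (EtaleThetaDataOfSetting.pairRhoLim C α β hφ (EtaleThetaDataOfSetting.mem_lDeltaTheta_iff_of_eq_self β hβ) (EtaleThetaDataOfSetting.mem_PiYdd_iff_of_piYddCharacteristic C hcharY α))).MxTM)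
              (w : (nonzeroIntegers (ThetaSetting.modelχq p 1 2 even_two).toTemperedCurve.mlfClosurePadic.k (ThetaSetting.modelχq p 1 2 even_two).toTemperedCurve.mlfClosurePadic.K)ˣ),
              (m : (EtaleLevels.thetaEvaluation C hC hS hlp hp2 hpl hζ τ.modAll f hf τ.red_modAll h15 L hZ hcharY (EtaleLevels.bijective_rigidLimHom C hC hS hlp hp2 hpl hζ τ.modAll f hf τ.red_modAll h15 L hZ) Env₀
                (EtaleThetaDataOfSetting.pointedInversionOfPair C hC hS hcharY (EtaleLevels.setting C hC hS hlp hp2 hpl hζ τ.modAll f hf)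
                  (ContinuousMulEquiv.refl _) rfl Env₀ α hover 1 hδ hαα γ hγ hαγ huniq Dμ hDmu hfixD etaStd hmem hstd)
                (LevelRetraction.ofAugmentation (EtaleThetaDataOfSetting.phi C) ((ThetaSetting.modelχq p 1 2 even_two).lDeltaTheta l)
                  (EtaleThetaDataOfSetting.aug C) Dμ (eq_one_of_mem_inrRange_subgroupOf_of_aug_eq_one p 1 2 even_two C) (EtaleThetaDataOfSetting.PiYdd C)
                  (EtaleThetaDataOfSetting.continuous_aug C) (EtaleLevels.aug_ker_acts_trivially C)
                  (hlift_of_isCompact (EtaleThetaDataOfSetting.aug C) Dμ (EtaleThetaDataOfSetting.continuous_aug C) (isCompact_inrRange_subgroupOf p 1 2 even_two C (inr_mem_Huuχq p 1 2 l hl)))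
                  (hemb_of_isCompact (EtaleThetaDataOfSetting.aug C) Dμ (EtaleThetaDataOfSetting.continuous_aug C) (isCompact_inrRange_subgroupOf p 1 2 even_two C (inr_mem_Huuχq p 1 2 l hl)) (eq_one_of_mem_inrRange_subgroupOf_of_aug_eq_one p 1 2 even_two C)))
                cU (EtaleThetaDataOfSetting.isOpen_stabilizer_units C) (EtaleThetaDataOfSetting.finiteIndex_stabilizer_units C)
                (unitGroup ℚ_[p] (PadicAlgCl p)) (EtaleThetaDataOfSetting.pairRhoLim C α β hφ (EtaleThetaDataOfSetting.mem_lDeltaTheta_iff_of_eq_self β hβ) (EtaleThetaDataOfSetting.mem_PiYdd_iff_of_piYddCharacteristic C hcharY α))).Hd) =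
                  Multiplicative.toAdd (h1LimKummer (EtaleThetaDataOfSetting.phi C) ((ThetaSetting.modelχq p 1 2 even_two).lDeltaTheta l) Dμ cU
                    (EtaleThetaDataOfSetting.isOpen_stabilizer_units C) (EtaleThetaDataOfSetting.finiteIndex_stabilizer_units C) u) →
              ((w : nonzeroIntegers (ThetaSetting.modelχq p 1 2 even_two).toTemperedCurve.mlfClosurePadic.k (ThetaSetting.modelχq p 1 2 even_two).toTemperedCurve.mlfClosurePadic.K) :
                  (ThetaSetting.modelχq p 1 2 even_two).toTemperedCurve.mlfClosurePadic.K) = ((u : (PadicAlgCl p)ˣ) : PadicAlgCl p) →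
                e (Multiplicative.ofAdd (QuotientAddGroup.mk m)) =
                  (AbsTopMonoids.genuineOfModelIsm (EtaleLevels.setting C hC hS hlp hp2 hpl hζ τ.modAll f hf) (ThetaSetting.modelχq p 1 2 even_two).toTemperedCurve.mlfClosurePadic
                      (ThetaSetting.modelχq p 1 2 even_two).toTemperedCurve.galoisEpsilonPadic hΔX hq).actIsm G gI
                    (QuotientGroup.mk (Units.map (AbsTopMonoids.Genuine.liftM (ThetaSetting.modelχq p 1 2 even_two).toTemperedCurve.mlfClosurePadic
                      (AbsTopMonoids.Genuine.phiOf (ThetaSetting.modelχq p 1 2 even_two).toTemperedCurve.mlfClosurePadic (ThetaSetting.modelχq p 1 2 even_two).toTemperedCurve.galoisEpsilonPadic φ)).toMonoidHom w))} := by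
  intro Dsec ι hιA hC hS K₀ C f hf h15 L hO hYcl hp2 hpl hζ hZ hq hι α hαα γ hγ hαγ hP Env₀ hδ h218i₁ hover hcharY Dμ hDmu hfixD
    huniq etaStd hmem hstd β hφ hΔX hβ tr htr hdesc hrev hfree G
  letI : IsNonarchimedeanLocalField ℚ_[p] := Padic.isNonarchimedeanLocalField_holds p
  haveI : FiniteDimensional ℚ_[p] (ThetaSetting.modelχq p 1 2 even_two).K :=
    (ThetaSetting.modelχq p 1 2 even_two).finiteDimensional_K
  haveI : ((ThetaSetting.modelχq p 1 2 even_two).lDeltaTheta l).Normal :=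
    (ThetaSetting.modelχq p 1 2 even_two).lDeltaTheta_normal l
  haveI : IsMulCommutative ((ThetaSetting.modelχq p 1 2 even_two).lDeltaTheta l) :=
    EtaleThetaDataOfSetting.instIsMulCommutative_lDeltaTheta (D := ThetaSetting.modelχq p 1 2 even_two) l
  letI : MulDistribMulAction (EtaleThetaDataOfSetting.Pi C) (PadicAlgCl p)ˣ := EtaleThetaDataOfSetting.unitsAction C
  haveI : IsGalois ℚ_[p] (AlgebraicClosure ℚ_[p]) := {}
  haveI : T2Space (GQp p) := krullTopology_t2
  haveI := finiteIndex_map_aug_inrRange_subgroupOf p 1 2 even_two C (inr_mem_Huuχq p 1 2 l hl)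
  -- the ABSTRACT-`D_{μ_-}` closer of record (abc-iut-w4-d043 gen 4) at `D_{μ_-} := Dμ`, `Env := Env₀`, `α := ι|Π^tp_X̲̲`, `δ := 1`
  exact @EtaleLevels.cor112_model_of_cyclotomeTower p _ (ThetaSetting.modelχq p 1 2 even_two) _ _ C hC hS
    hlp hp2 hpl hζ τ.modAll f hf τ.red_modAll h15 L hZ hcharY
    (EtaleLevels.bijective_rigidLimHom C hC hS hlp hp2 hpl hζ τ.modAll f hf τ.red_modAll h15 L hZ) Env₀ α hover 1 hδ hαα γ hγ
    hαγ huniq Dμ hDmu hfixD etaStd hmem hstd β hφ (EtaleThetaDataOfSetting.mem_lDeltaTheta_iff_of_eq_self β hβ)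
    (EtaleThetaDataOfSetting.mem_PiYdd_iff_of_piYddCharacteristic C hcharY α)
    (eq_one_of_mem_inrRange_subgroupOf_of_aug_eq_one p 1 2 even_two C)
    (isCompact_inrRange_subgroupOf p 1 2 even_two C (inr_mem_Huuχq p 1 2 l hl)) (↥(ThetaSetting.modelχq p 1 2 even_two).K) _
    (FiniteExtension.valuativeRel ℚ_[p] (ThetaSetting.modelχq p 1 2 even_two).K)
    (FiniteExtension.topologicalSpace ℚ_[p] (ThetaSetting.modelχq p 1 2 even_two).K)
    (FiniteExtension.isNonarchimedeanLocalField ℚ_[p] (ThetaSetting.modelχq p 1 2 even_two).K)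
    (charZero_of_injective_algebraMap (algebraMap ℚ_[p] (ThetaSetting.modelχq p 1 2 even_two).K).injective) _
    (Literature.FieldTheory.Galois.isAlgClosure_of_intermediateField (ThetaSetting.modelχq p 1 2 even_two).K) _
    (ThetaSetting.modelχq p 1 2 even_two).finiteDimensional_K _
    (ThetaSetting.modelχq p 1 2 even_two).toTemperedCurve.galoisEpsilonPadic hΔX hq _ _ hO
    (isCompact_deltaTheta_modelχq p 1 2 even_two) (EtaleThetaDataOfSetting.aug_inversionAlpha C ι hι hιA) hβ tr htr hdesc
    hrev hfree G

end Tate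

end ModelTateCarriers

end Literature.IUT.HodgeArakelov

end
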